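import Literature.MathematicalPhysics.QuantumFieldTheory.Balaban1983to89.B8Lemma1NonAbelian
import HarnessLib

/-!
# NE7 — THE ABELIAN AXIAL HOMOTOPY ON THE LATTICE (F307a): for an `E`-valued bond field `A` and the axial potential `ψ(x) = A(Γ_{y,x})`, the defect
# `A(x,μ) − (ψ(x+e_μ) − ψ(x))` is a sum of `Σ_{κ<μ}|x_κ − y_κ|` plaquette values `dA`, hence `‖A − dψ‖ ≤ |x − y|₁·sup|dA|` on the box — the lattice Poincaré lemma
# with the homotopy operator written out; obtained from the NON-ABELIAN tree-gauge identity of [Balaban1985Averaging] pp. 24–25 (lit-balaban's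
# `B8Lemma1NonAbelian.axial_bond_eq_sharp`, stated for ANY group) at the group `Multiplicative E`

Cell `pub-balaban`, rung (B)+1 sub-cell t4, lineage `b2b-balaban-t4-ne7-p1` (CRUX PROVER NE7 #1 = OWNER of row NE7), generation 92; memo
`t4/b2b-balaban-t4-ne7-p1-g92/LOG-OBSTRUCTION.md` §4b (ROAD (U) brick (B2-i): the coercivity ∕ Neumann–Poincaré letter of a co-closed 1-form on a cube needs exactly
this homotopy bound).  Over lit-balaban's `B7Prop1Explicit` (`hol`, `asum`, `treeWord`, `ladder`, `lplaqWord`, `hol_ladder_cons`) and `B8Lemma1NonAbelian`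
(`axial_bond_eq_sharp`, `lowPart`, `forward_of_mem_treeWord`, `disp_nonneg_of_forward`).

WHY.  ROAD (U) for the sup letter of the cube Landau gauge (memo §4b) needs first the L² coercivity of Neumann-co-closed 1-forms on a cube, `‖A‖_{ℓ²(Q)} ≤ |Q|^{1∕2}·C·R·sup|dA|`,
whose proof is `⟨A, A⟩ = ⟨A, A − dψ⟩` (A ⊥ gradients) with the axial potential `ψ` and the POINTWISE homotopy bound `‖(A − dψ)(b)‖ ≤ (d+1)R·sup|dA|`.  The latter is the
abelian shadow of the non-abelian Stokes identity the tree already holds for every group: `V₀(x,x+e_μ) = V₀(Q)⁻¹·V₀(ladder Q μ)·V₀(Q)` in the axial gauge `V₀`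
(`axial_bond_eq_sharp`).  At `G = Multiplicative E` conjugations disappear, `toAdd ∘ hol = asum`, the gauged field is `A − dψ`, the ladder holonomy is a sum of `|Q|`
elementary loop sums, and each elementary loop sum is a plaquette value `±dA` (abelian curvature is gauge invariant).  No new combinatorics: the tree's identity, read
additively.
WHAT ([folklore]; 0 def, 0 sorry; generic `d`, `E` a normed ring — e.g. `M_n(ℂ)`).  §1 `toAdd_stepHol`, `toAdd_hol`, `toAdd_gaugeAct` (the dictionary `Multiplicative E ↔ E`).  §2 `asum_ladder_nil`,
`asum_ladder_cons`, `asum_lplaqWord_true∕false`, `norm_asum_ladder_le_local` (abelian ladder recursion and bound).  §3 **`axial_defect_eq_asum_ladder`** (the identity)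
and **`norm_axial_defect_le`** (the local bound `‖A(x,μ) + ψ(x) − ψ(x+e_μ)‖ ≤ |lowPart μ (x − y)|₁·a` when `‖dA‖ ≤ a` on the plaquettes of `[lo, hi] ⊇ [y, x + e_μ]`).
HONEST FRAMING (page 1): elementary lattice calculus; nothing of Bałaban's asserted ([Balaban1985Averaging] pp. 24–25 is the TEXT LOCATION of the axial gauge, used BY NAME
through lit-balaban's transcription); NE7 NOT PROVED; spine 0∕9; finite T⁴ rung (B)+1 — NOT infinite volume, NOT mass gap, NOT `BetaPertH`, NOT Clay.  Continuum YM on T⁴ ⇐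
BetaPertH ∧ nine spine estimates (0/9 proved); BetaPertH ⇐ (D1) ∧ (D4) ∧ CAP+tail; G-an2-4 gates asym, D1 and NE2/3/4.  No `sorry`; axioms ⊆ {propext, Classical.choice,
Quot.sound}.
-/

set_option autoImplicit false

open scoped BigOperators
open Finset

namespace Summit.QuantumFields.BalabanUV.T4Continuum.NE7AbelianAxialHomotopy

open Literature.MathematicalPhysics.QuantumFieldTheory.Balaban1983to89
open B7Prop1Explicit
open B8Lemma1NonAbelian (lowPart lowPart_apply lowPart_nonneg lowPart_le_self axial_bond_eq_sharp forward_of_mem_treeWord ne_zero_of_mem_treeWord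
  disp_nonneg_of_forward)

variable {d : ℕ} {E : Type*} [NormedRing E]

/-! ## §1 The dictionary `Multiplicative E ↔ E` -/

section Dictionary

/-- One letter: `toAdd V(l) = ±A_b`. [folklore] -/
theorem toAdd_stepHol (A : Site d → Fin d → E) (x : Site d) (l : Letter d) :
    Multiplicative.toAdd (stepHol (fun z ν => Multiplicative.ofAdd (A z ν)) x l) = stepA A x l := by
  obtain ⟨κ, b⟩ := l
  cases b
  · simp only [stepHol, Bool.false_eq_true, ↓reduceIte, toAdd_inv, toAdd_ofAdd]; rfl
  · simp only [stepHol, ↓reduceIte, toAdd_ofAdd]; rfl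

/-- `toAdd ∘ hol = asum`: the holonomy of the `Multiplicative E`-valued field `e^{A}` along a word is the abelian sum `A(Γ)`. [folklore] -/
theorem toAdd_hol (A : Site d → Fin d → E) : ∀ (x : Site d) (w : List (Letter d)),
    Multiplicative.toAdd (hol (fun z ν => Multiplicative.ofAdd (A z ν)) x w) = asum A x w
  | x, [] => by simp
  | x, l :: w => by
    rw [hol_cons, asum_cons, toAdd_mul, toAdd_stepHol, toAdd_hol A (x + l.vec) w]

/-- The gauge action, read additively: `toAdd (u(x)·V(x,μ)·u(x+e_μ)⁻¹) = toAdd u(x) + toAdd V(x,μ) − toAdd u(x+e_μ)`. [folklore] -/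
theorem toAdd_gaugeAct (u : Site d → Multiplicative E) (V : Site d → Fin d → Multiplicative E) (x : Site d) (μ : Fin d) :
    Multiplicative.toAdd (gaugeAct u V x μ) = Multiplicative.toAdd (u x) + Multiplicative.toAdd (V x μ) - Multiplicative.toAdd (u (x + e μ)) := by
  simp only [gaugeAct, toAdd_mul, toAdd_inv, sub_eq_add_neg]

end Dictionary

/-! ## §2 The abelian ladder -/

section Ladder

/-- The empty ladder sums to zero. [folklore] -/
theorem asum_ladder_nil (B : Site d → Fin d → E) (x : Site d) (μ : Fin d) : asum B x (ladder [] μ) = 0 := by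
  have h := congrArg Multiplicative.toAdd (hol_ladder (fun z ν => Multiplicative.ofAdd (B z ν)) x [] μ)
  rw [toAdd_hol] at h
  rw [h]
  simp

/-- The abelian ladder recursion: `B(ladder (l :: Q)) = B(ladder Q, from x + l) + B(elementary loop of l)` (`hol_ladder_cons` at `Multiplicative E`). [folklore] -/
theorem asum_ladder_cons (B : Site d → Fin d → E) (x : Site d) (l : Letter d) (w : List (Letter d)) (μ : Fin d) :
    asum B x (ladder (l :: w) μ) = asum B (x + l.vec) (ladder w μ) + asum B x (lplaqWord l μ) := by
  have h := congrArg Multiplicative.toAdd (hol_ladder_cons (fun z ν => Multiplicative.ofAdd (B z ν)) x l w μ)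
  rw [toAdd_hol, toAdd_mul, toAdd_mul, toAdd_mul, toAdd_inv, toAdd_hol, toAdd_hol] at h
  rw [h]; abel

/-- The elementary loop of a forward letter is a plaquette: `B(lplaqWord (κ,+) μ) = dB(x; κ, μ)`. [folklore] -/
theorem asum_lplaqWord_true (B : Site d → Fin d → E) (x : Site d) (κ μ : Fin d) :
    asum B x (lplaqWord (κ, true) μ) = B x κ + B (x + e κ) μ - B (x + e μ) κ - B x μ := by
  rw [lplaqWord_true, asum_plaqWord]

/-- The elementary loop of a backward letter is minus the plaquette below: `B(lplaqWord (κ,−) μ) = −dB(x − e_κ; κ, μ)`. [folklore] -/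
theorem asum_lplaqWord_false (B : Site d → Fin d → E) (x : Site d) (κ μ : Fin d) :
    asum B x (lplaqWord (κ, false) μ) = -(B (x - e κ) κ + B (x - e κ + e κ) μ - B (x - e κ + e μ) κ - B (x - e κ) μ) := by
  simp only [lplaqWord, asum_cons, asum_nil, Letter.rev, Letter.vec, stepA, Bool.not_false, Bool.false_eq_true, ↓reduceIte]
  rw [show x + -e κ = x - e κ by abel, show x - e κ + e μ + e κ + -e μ = x - e κ + e κ by abel, show x - e κ + e κ = x by abel]
  abel

/-- **THE ABELIAN LADDER BOUND, LOCAL**: if every elementary loop met along `Q` (letters `≠ ±e_μ`) sums to at most `a` in norm, then `‖B(ladder Q μ)‖ ≤ |Q|·a`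
(`B8Lemma1NonAbelian.ladder_bound_local`, additively). [folklore] -/
theorem norm_asum_ladder_le_local (B : Site d → Fin d → E) (μ : Fin d) {a : ℝ} :
    ∀ (w : List (Letter d)) (x : Site d),
      (∀ (w₁ w₂ : List (Letter d)) (l : Letter d), w = w₁ ++ l :: w₂ → ‖asum B (x + disp w₁) (lplaqWord l μ)‖ ≤ a) →
      ‖asum B x (ladder w μ)‖ ≤ w.length * a
  | [], x, _ => by rw [asum_ladder_nil, norm_zero]; simp
  | l :: w, x, hP => by
    rw [asum_ladder_cons, List.length_cons, Nat.cast_succ, add_mul, one_mul]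
    have ih := norm_asum_ladder_le_local B μ w (x + l.vec)
      (fun w₁ w₂ l' h => by
        have := hP (l :: w₁) w₂ l' (by rw [h]; rfl)
        rwa [disp_cons, ← add_assoc] at this)
    have hl := hP [] w l rfl
    rw [disp_nil, add_zero] at hl
    exact (norm_add_le _ _).trans (add_le_add ih hl)

end Ladder

/-! ## §3 The axial defect: identity and local bound -/

section Defect

/-- **THE ABELIAN AXIAL HOMOTOPY IDENTITY.**  With the axial potential `ψ(z) = A(Γ_{y,z}) = asum A y (treeWord (z − y))` and the gauged (defect) field
`A₀(z,ν) = ψ(z) + A(z,ν) − ψ(z + e_ν)`: `A₀(x,μ) = A₀(ladder Q μ)` summed from `w = x − lowPart μ (x − y)`, `Q = treeWord (lowPart μ (x − y))` — the tree-gauge identity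
`axial_bond_eq_sharp` at the group `Multiplicative E`. [folklore] -/
theorem axial_defect_eq_asum_ladder (A : Site d → Fin d → E) (y x : Site d) (μ : Fin d) :
    asum A y (treeWord (x - y)) + A x μ - asum A y (treeWord (x + e μ - y))
      = asum (fun z ν => asum A y (treeWord (z - y)) + A z ν - asum A y (treeWord (z + e ν - y)))
          (x - lowPart μ (x - y)) (ladder (treeWord (lowPart μ (x - y))) μ) := by
  set V : Site d → Fin d → Multiplicative E := fun z ν => Multiplicative.ofAdd (A z ν) with hV
  have hid := congrArg Multiplicative.toAdd (axial_bond_eq_sharp V y x μ)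
  -- the left side
  have hψ : ∀ z : Site d, Multiplicative.toAdd (axialFn V y z) = asum A y (treeWord (z - y)) := fun z => by
    unfold axialFn; rw [hV, toAdd_hol]
  rw [toAdd_gaugeAct, hψ, hψ, show Multiplicative.toAdd (V x μ) = A x μ by simp [hV]] at hid
  -- the right side: conjugation disappears, the gauged field read additively
  set V₀ : Site d → Fin d → Multiplicative E := gaugeAct (axialFn V y) V with hV₀
  have hA₀ : V₀ = fun z ν => Multiplicative.ofAdd (asum A y (treeWord (z - y)) + A z ν - asum A y (treeWord (z + e ν - y))) := by
    funext z ν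
    apply Multiplicative.toAdd.injective
    rw [toAdd_ofAdd, hV₀, toAdd_gaugeAct, hψ, hψ, show Multiplicative.toAdd (V z ν) = A z ν by simp [hV]]
  rw [toAdd_mul, toAdd_mul, toAdd_inv, hA₀, toAdd_hol, toAdd_hol] at hid
  rw [hid]; abel

/-- The defect field has the same plaquette sums as `A` (abelian curvature is gauge invariant: `d∘d = 0`). [folklore] -/
theorem asum_plaqWord_defect (A : Site d → Fin d → E) (y p : Site d) (κ μ : Fin d) :
    asum (fun z ν => asum A y (treeWord (z - y)) + A z ν - asum A y (treeWord (z + e ν - y))) p (plaqWord κ μ)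
      = asum A p (plaqWord κ μ) := by
  rw [asum_plaqWord, asum_plaqWord, show p + e κ + e μ = p + e μ + e κ by abel]
  abel

/-- **THE LOCAL HOMOTOPY BOUND.**  For `lo ≤ y ≤ x`, `x + e_μ ≤ hi`, and `‖dA(p; κ, ν)‖ ≤ a` for every plaquette with `lo ≤ p`, `p + e_κ + e_ν ≤ hi`, `κ ≠ ν`:
`‖ψ(x) + A(x,μ) − ψ(x + e_μ)‖ ≤ |lowPart μ (x − y)|₁·a` (`≤ |x − y|₁·a`) — the abelian shadow of `axial_bond_bound_sharp`. [folklore] -/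
theorem norm_axial_defect_le (A : Site d → Fin d → E) {lo hi : Site d} {a : ℝ}
    (hP : ∀ (p : Site d) (κ ν : Fin d), κ ≠ ν → lo ≤ p → p + e κ + e ν ≤ hi → ‖asum A p (plaqWord κ ν)‖ ≤ a)
    (y x : Site d) (μ : Fin d) (hlo : lo ≤ y) (hyx : y ≤ x) (hhi : x + e μ ≤ hi) :
    ‖asum A y (treeWord (x - y)) + A x μ - asum A y (treeWord (x + e μ - y))‖ ≤ l1 (lowPart μ (x - y)) * a := by
  rw [axial_defect_eq_asum_ladder]
  set A₀ : Site d → Fin d → E := fun z ν => asum A y (treeWord (z - y)) + A z ν - asum A y (treeWord (z + e ν - y)) with hA₀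
  set Lo : Site d := lowPart μ (x - y) with hLo
  set w : Site d := x - Lo with hw
  set Q : List (Letter d) := treeWord Lo with hQ
  have hLo0 : 0 ≤ Lo := lowPart_nonneg μ (sub_nonneg.mpr hyx)
  have hLole : Lo ≤ x - y := lowPart_le_self μ (sub_nonneg.mpr hyx)
  have hyw : y ≤ w := by
    rw [hw]; intro κ; have := hLole κ; simp only [Pi.sub_apply] at this ⊢; linarith
  have hfw : ∀ l ∈ Q, l = (l.1, true) := fun l hl => forward_of_mem_treeWord hLo0 hl
  have hQμ : ∀ l ∈ Q, l.1 ≠ μ := by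
    intro l hl hlμ
    have h0 := ne_zero_of_mem_treeWord hl
    rw [hlμ, hLo, lowPart_apply, if_neg (lt_irrefl μ)] at h0
    exact h0 rfl
  have hP' : ∀ (w₁ w₂ : List (Letter d)) (l : Letter d), Q = w₁ ++ l :: w₂ → ‖asum A₀ (w + disp w₁) (lplaqWord l μ)‖ ≤ a := by
    intro w₁ w₂ l hsplit
    have hl : l ∈ Q := by rw [hsplit]; simp
    have hlf := hfw l hl
    have hκμ : l.1 ≠ μ := hQμ l hl
    have h01 : (0 : Site d) ≤ disp w₁ := disp_nonneg_of_forward fun l' hl' => hfw l' (by rw [hsplit]; simp [hl'])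
    have h02 : (0 : Site d) ≤ disp w₂ := disp_nonneg_of_forward fun l' hl' => hfw l' (by rw [hsplit]; simp [hl'])
    have hsum : disp w₁ + e l.1 + disp w₂ = Lo := by
      have := disp_treeWord Lo
      rw [← hQ, hsplit, disp_append, disp_cons, hlf] at this
      simpa [add_assoc] using this
    rw [hlf, lplaqWord_true, hA₀, asum_plaqWord_defect]
    refine hP _ _ _ hκμ ?_ ?_
    · exact hlo.trans (hyw.trans (le_add_of_nonneg_right h01))
    · calc w + disp w₁ + e l.1 + e μ = w + (disp w₁ + e l.1) + e μ := by abel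
        _ ≤ w + Lo + e μ := by
          have : disp w₁ + e l.1 ≤ Lo := by rw [← hsum]; exact le_add_of_nonneg_right h02
          exact add_le_add (add_le_add le_rfl this) le_rfl
        _ = x + e μ := by rw [hw, sub_add_cancel]
        _ ≤ hi := hhi
  have hlad := norm_asum_ladder_le_local A₀ μ Q w hP'
  refine hlad.trans (le_of_eq ?_)
  rw [hQ, length_treeWord]

/-- `|lowPart μ v|₁ ≤ |v|₁` for `0 ≤ v`, hence the defect is at most `|x − y|₁·a`. [folklore] -/
theorem norm_axial_defect_le' (A : Site d → Fin d → E) {lo hi : Site d} {a : ℝ} (ha : 0 ≤ a)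
    (hP : ∀ (p : Site d) (κ ν : Fin d), κ ≠ ν → lo ≤ p → p + e κ + e ν ≤ hi → ‖asum A p (plaqWord κ ν)‖ ≤ a)
    (y x : Site d) (μ : Fin d) (hlo : lo ≤ y) (hyx : y ≤ x) (hhi : x + e μ ≤ hi) :
    ‖asum A y (treeWord (x - y)) + A x μ - asum A y (treeWord (x + e μ - y))‖ ≤ l1 (x - y) * a := by
  refine (norm_axial_defect_le A hP y x μ hlo hyx hhi).trans (mul_le_mul_of_nonneg_right ?_ ha)
  have h0 : 0 ≤ x - y := sub_nonneg.mpr hyx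
  have h1 := lowPart_nonneg μ h0
  have h2 := lowPart_le_self μ h0
  unfold l1
  push_cast
  refine Finset.sum_le_sum fun κ _ => ?_
  have a1 : 0 ≤ lowPart μ (x - y) κ := h1 κ
  have a2 : lowPart μ (x - y) κ ≤ (x - y) κ := h2 κ
  have e1 : ((lowPart μ (x - y) κ).natAbs : ℤ) = lowPart μ (x - y) κ := Int.natAbs_of_nonneg a1
  have e2 : (((x - y) κ).natAbs : ℤ) = (x - y) κ := Int.natAbs_of_nonneg (a1.trans a2)
  have : ((lowPart μ (x - y) κ).natAbs : ℤ) ≤ (((x - y) κ).natAbs : ℤ) := by rw [e1, e2]; exact a2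
  exact_mod_cast this

end Defect

end Summit.QuantumFields.BalabanUV.T4Continuum.NE7AbelianAxialHomotopy
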